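import Mathlib
import Summits.Ventures.HodgeRepro2.T7SupportTwoTorusInvariant
import Summits.Ventures.HodgeRepro2.Tier7.Line3.KappaCongruence

/-!
# Tier7/Line3/KappaBound — `κ` is bounded / integral on the compact support (seat t7-x1)

LINE 3 (t7-plan-3), version-(ii) isolation: the finite-place hypotheses `hS` («`|κ(γ) − κ(γ₀)|_w ≤ B_w` at the
finitely many finite places `w ∈ S`») and `hout` («`|κ(γ) − κ(γ₀)|_w ≤ 1` at every other finite place») of the
separation lemma `ProductFormulaSeparation.inv_mul_pow_le_archSizeOn` (crit-2 l. 14949: «hS / hout — open»). THIS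
FILE supplies them at the model level of `T7SupportTwoTorusInvariant` (row 662): over a field `E` with involution
`σ` and a non-archimedean `σ`-invariant absolute value, an isometry `γ` whose entries, together with those of the
second basis vector `f 0` and of `d 0`, are `≤ M` has `|κ(γ)| ≤ M⁶ / |d₀ d′₀|`; with `M = 1` and `|d₀ d′₀| = 1`
(an integral `γ ∈ K_w`, integral adapted bases, unit discriminants — every `w ∉ S`) this is `|κ(γ)| ≤ 1`, and
`|κ(γ) − κ(γ₀)| ≤ 1` by the ultrametric inequality. By p1's invariance `kappa_diag_mul` the bound holds on the
whole double coset `T_A γ T_B`.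

Pure algebra in the explicit model; nothing here is about an adelic group, an orbital integral or a period. Blind
lane: Mathlib + the HodgeRepro2 prefix only; no sorry; axioms ⊆ {propext, Classical.choice, Quot.sound}.
-/

namespace Summit.Ventures.HodgeRepro2.Tier7.Line3.KappaBound

open Summit.Ventures.HodgeRepro2.T7SupportTwoTorusInvariant
  Summit.Ventures.HodgeRepro2.Tier7.Line3.KappaCongruence Matrix

variable {E : Type*} [Field E] (σ : E →+* E) (abv : AbsoluteValue E ℝ)

/-- the norm is bounded by the square: `abv (N x) = abv x ^ 2`. -/
theorem abv_nrm (hσ : ∀ x, abv (σ x) = abv x) (x : E) : abv (nrm σ x) = abv x ^ 2 := by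
  rw [nrm, abv.map_mul, hσ, sq]

/-- **`|κ(γ)| ≤ M⁶ / |d₀ d′₀|`** for entries of `γ`, `f 0`, `d 0` of size `≤ M`. -/
theorem abv_kappa_le (hna : IsNonarchimedean abv) (hσ : ∀ x, abv (σ x) = abv x)
    (d : Fin 2 → E) (f : Fin 2 → Fin 2 → E) (γ : Matrix (Fin 2) (Fin 2) E) {M : ℝ} (hM : 0 ≤ M)
    (hγ : ∀ i j, abv (γ i j) ≤ M) (hf : ∀ i, abv (f 0 i) ≤ M) (hd : abv (d 0) ≤ M) :
    abv (kappa σ d f γ) ≤ M ^ 6 / abv (d 0 * disc' σ d f 0) := by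
  have hc : abv (cc d f γ 0 0) ≤ M ^ 3 := abv_cc_le abv hna d f γ hM hγ hf hd
  have hn : abv (nrm σ (cc d f γ 0 0)) ≤ M ^ 6 := by
    rw [abv_nrm σ abv hσ]
    calc abv (cc d f γ 0 0) ^ 2 ≤ (M ^ 3) ^ 2 := pow_le_pow_left₀ (abv.nonneg _) hc 2
      _ = M ^ 6 := by ring
  rw [kappa, map_div₀ abv]
  by_cases hden : abv (d 0 * disc' σ d f 0) = 0
  · rw [hden, div_zero, div_zero]
  · have hpos : 0 < abv (d 0 * disc' σ d f 0) := lt_of_le_of_ne (abv.nonneg _) (Ne.symm hden)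
    exact div_le_div_of_nonneg_right hn hpos.le

/-- **the unit case**: integral entries (`≤ 1`) and unit discriminants (`|d₀ d′₀| = 1`) give `|κ(γ)| ≤ 1`. -/
theorem abv_kappa_le_one (hna : IsNonarchimedean abv) (hσ : ∀ x, abv (σ x) = abv x)
    (d : Fin 2 → E) (f : Fin 2 → Fin 2 → E) (γ : Matrix (Fin 2) (Fin 2) E)
    (hγ : ∀ i j, abv (γ i j) ≤ 1) (hf : ∀ i, abv (f 0 i) ≤ 1) (hd : abv (d 0) ≤ 1)
    (hdisc : abv (d 0 * disc' σ d f 0) = 1) :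
    abv (kappa σ d f γ) ≤ 1 := by
  have h := abv_kappa_le σ abv hna hσ d f γ zero_le_one hγ hf hd
  rwa [hdisc, one_pow, div_one] at h

/-- **`hout` in the model**: two integral isometries `γ`, `γ₀` (unit discriminants) have `|κ(γ) − κ(γ₀)| ≤ 1`. -/
theorem abv_kappa_sub_kappa_le_one (hna : IsNonarchimedean abv) (hσ : ∀ x, abv (σ x) = abv x)
    (d : Fin 2 → E) (f : Fin 2 → Fin 2 → E) (γ γ₀ : Matrix (Fin 2) (Fin 2) E)
    (hγ : ∀ i j, abv (γ i j) ≤ 1) (hγ₀ : ∀ i j, abv (γ₀ i j) ≤ 1) (hf : ∀ i, abv (f 0 i) ≤ 1)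
    (hd : abv (d 0) ≤ 1) (hdisc : abv (d 0 * disc' σ d f 0) = 1) :
    abv (kappa σ d f γ - kappa σ d f γ₀) ≤ 1 := by
  have h1 := abv_kappa_le_one σ abv hna hσ d f γ hγ hf hd hdisc
  have h2 := abv_kappa_le_one σ abv hna hσ d f γ₀ hγ₀ hf hd hdisc
  have h := hna (kappa σ d f γ) (-(kappa σ d f γ₀))
  rw [← sub_eq_add_neg, abv.map_neg] at h
  exact h.trans (max_le h1 h2)

/-- **`hS` / `hout` on the whole double coset**: the bound `|κ| ≤ M⁶ / |d₀ d′₀|` is a bound on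
`T_A γ T_B` (p1's `kappa_diag_mul`). -/
theorem abv_kappa_le_of_double_coset (hna : IsNonarchimedean abv) (hσ : ∀ x, abv (σ x) = abv x)
    (d : Fin 2 → E) (f : Fin 2 → Fin 2 → E) (γ t' : Matrix (Fin 2) (Fin 2) E) (a b : Fin 2 → E)
    (ha : nrm σ (a 0) = 1) (hb0 : nrm σ (b 0) = 1) (hb : ActsOn f t' b) {M : ℝ} (hM : 0 ≤ M)
    (hγ : ∀ i j, abv (γ i j) ≤ M) (hf : ∀ i, abv (f 0 i) ≤ M) (hd : abv (d 0) ≤ M) :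
    abv (kappa σ d f (diagonal a * γ * t')) ≤ M ^ 6 / abv (d 0 * disc' σ d f 0) := by
  rw [kappa_diag_mul σ d f γ t' a b ha hb0 hb]
  exact abv_kappa_le σ abv hna hσ d f γ hM hγ hf hd

end Summit.Ventures.HodgeRepro2.Tier7.Line3.KappaBound
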